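import Summits.KontsevichZagierPeriods.KontsevichZagierPeriods.Theses.Deregularisation

/-!
# `Assembly` (stmt-KontsevichZagierPeriods-3909, route Deregularisation) — proof

The route's assembly item `DeregularisationShell → KontsevichZagierPeriods` is its gate-verified
deciding theorem
`Summit.KontsevichZagierPeriods.KontsevichZagierPeriods.Theses.Deregularisation.closes` read as an
implication (binders reordered / dropped as needed); the antecedents are the route's cruxes and are
NOT discharged here: the theorem is the implication, nothing more. (Lead c10 of crux
stmt-KontsevichZagierPeriods-9129, banking.) No definitions are introduced.

References: M. Kontsevich, D. Zagier, *Periods* (2001), §1.2, Conjecture 1.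
-/

namespace Summit.KontsevichZagierPeriods.Deregularisation

/-- **Assembly of route Deregularisation** (stmt-KontsevichZagierPeriods-3909):
`DeregularisationShell → KontsevichZagierPeriods` — the cruxes imply the summit, by the route's
deciding theorem `closes`. [Kontsevich–Zagier 2001, §1.2] [folklore] -/
theorem assembly_proof :
    Summit.KontsevichZagierPeriods.KontsevichZagierPeriods.Theses.Deregularisation.Assembly :=
  fun h₁ =>
    Summit.KontsevichZagierPeriods.KontsevichZagierPeriods.Theses.Deregularisation.closes h₁

end Summit.KontsevichZagierPeriods.Deregularisation
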